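import Summits.QuantumAdvantage.QuantumAdvantage.Theses.LinnikCubicClassGroups
import Literature.Computability.Cryptography.Shor
import Literature.Computability.Cryptography.ShorProofs
import Literature.Computability.Cryptography.ShorAssemblyLeavesProofs
import Literature.Computability.Complexity.BoolEncodings
import Literature.Computability.Complexity.StackLists

/-!
# Line `regulator-first-exact-modes` — skeleton for the crux `LinnikCubicClassGroups.PureCubicClassGroupFBQP`
(crux item stmt-QuantumAdvantage-11544, rank 3, route `route-QuantumAdvantage-LinnikCubicClassGroups`;
crux-plan generation 2 — supersedes the generation-0 skeleton of the same name, see "CHANGES" below)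

Crux (FIXED, by name): `DegreeOnePrimesEscape → ∃ f ∈ FBQP, |f x| = 2|x|+8 ∧ f x = low bits of h(K)` for
every cubic number field `K ∋ ∛m`, `m = decodeNat x` a non-cube (all such `K ≅ ℚ(∛m)`: a COMPLEX cubic
field, signature `(1,1)`, unit rank ONE, regulator `R = |log|σ₁ ε||`).

Idea (crux idea card `regulator-first-exact-modes`; triage r1-1/2/3: pass; merge-line "LINE P" =
`arakelov-giant-step-cycle` (front: cycle oracle + R) → `one-blurred-coordinate` (middle: concentration of
the joint `ℤ_M^T × ℤ_q` Fourier sampling) → `regulator-first-exact-modes` (back: exact modes + Howell)):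
"Hallgren's circuit, Kitaev's reading". Compute `R` FIRST (GRH-free; the cubic twin of the tree's PROVED
`Hallgren2007_regulator_qsolvable_holds`); then every Fourier sample `(u, c)` of the cycle oracle
`(e, j) ↦ reduced Arakelov divisor at (∏ Pᵢ^{eᵢ}, distance jδ)` has continuous dual coordinate
`c ≈ k·(qδ/R)` for an EXACT INTEGER mode `k` (because `(0, R)` lies in the hidden lattice
`L̃ = {(v, (ω(v)+n)R) : v ∈ Λ, n ∈ ℤ} ⊂ ℤ^T × ℝ`, whose dual is `{(u, k/R) : ⟨u,v⟩ + kω(v) ∈ ℤ ∀ v ∈ Λ}`);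
integer kernel combinations `Σ cⱼkⱼ = 0` of the samples land in `Λ*/ℤ^T` (a FINITE group of order
`[ℤ^T : Λ] = h` when the primes generate), continued fractions make them exact, and an HNF/Howell
computation returns the order.

THE LINE (7 registered stubs, composed by `PureCubicClassGroupFBQP_of`, kernel-checked):
* `stub_regulator` (S1, front; L–XL): a uniform oracle-free Clifford+T family which, on
  `encReg x k = ⟨x, ⟨primeFactorsList m, 1^k⟩⟩` (the factorisation of `m` is SUPPLIED — no Shor inside),
  outputs a self-delimited integer `r` with `|r − 2^k·R_K| ≤ 1` for every admissible `K`, with probability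
  `≥ 15/16`: the cubic twin of the tree's PROVED `Hallgren2007_regulator_qsolvable_delim_holds`
  (`HallgrenPellQuantum.lean`: `GiantStepCycle` + `ShiftSampling` + comb-mass + CF + candidate check),
  the principal cycle being the complex-cubic infrastructure (Voronoi; Williams–Dueck–Schmid 1983,
  Buchmann–Williams 1988; Schoof 2008 Alg. 10.3–10.8; card `arakelov-giant-step-cycle`, 6-gap packing).
* `stub_escapeSampling` (S2; M–L): `DegreeOnePrimesEscape → EscapeGeneration` — THIS IS WHERE THE CRUX'S
  HYPOTHESIS IS USED (Disproof `not_crux_iff`: a disproof must PROVE `DegreeOnePrimesEscape`). NEW DRAW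
  RULE (gen 2): a draw is `(r, t) ∈ [0,2^{n₀})²`; the pair is `(q, r mod q)` with `q` the `t`-th (cyclically)
  distinct prime factor of `|r³ − m|` — so `r` IS a cube root of `m` mod `q` for free and the classical side
  needs NO modular cube-root algorithm (none in the tree), only factoring (`FACT ∈ BQP`, in tree). With
  `2^{n₀} > (3m)^C` (`C ≥ max(3·C(3), 7)`, so `|d_K|^{C(3)} ≤ (27m²)^{C(3)} ≤ 2^{n₀} − 1` and `m < 2^{n₀}`: at most
  `log₂(3m)+1 ≤ n₀+2` primes `q ∣ 3m` are excluded — NO cube-free promise is needed any more) and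
  `T ≥ c(|x|+n₀+1)⁴` draws, all but `≤ 1/8` of the draw sequences give classes generating `Cl(O_K)`
  (escape count at `n = 3`, Chebyshev `π(N) ≥ N/(4 log N)` = tree `Sieve.div_four_mul_log_le_primeCounting`,
  route support `RandomSamplesGenerate`, tree `card_subgroup_le`).
* `stub_dualSampler` (S3, middle; XL, HARDEST — the honest bet of the card, = `one-blurred-coordinate`'s
  `CoherentCombsMass` + the cycle oracle of `arakelov-giant-step-cycle` + product law of `s` parallel units):
  ONE uniform oracle-free Clifford+T family which, on `encInst x pairs s n₁ = ⟨x, ⟨primeFactorsList m, ⟨pairs,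
  ⟨1^s, 1^{n₁}⟩⟩⟩⟩` with `s ≥ c(|x|+T+1)`, `n₁ ≥ c(|x|+T+s+1)` and the PROMISE `R ≤ 2^{n₁}` (window sizes
  `M = q = 2^{8n₁}`, `δ = 2^{−3n₁}`, `J = 2^{n₁}`, `τ = 2^{−n₁}`), outputs `s` samples `(uⱼ, cⱼ) ∈ [0,M)^T × [0,q)`
  such that with probability `≥ 7/8` the sample set is `Good` for SOME shift function `ω : Λ → ℝ` (gen 2: `ω`
  is existential — the intended witness is the archimedean character `v ↦ log|σ₁(α_v)|/R`, but its sign /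
  normalisation conventions are the prover's; S4 is `ω`-universal): (i) SOUNDNESS — every sample whose mode
  statistic `κ = symm(c)·R/(qδ)` is within `2τ` of an integer `k` is `J`-close to a point of the mode-`k`
  shifted dual `{u : ⟨u,v⟩ + kω(v) ∈ ℤ ∀ v ∈ Λ}`; (ii) COMPLETENESS — kernel combinations of the dual points of
  the inner-accepted samples (`κ` within `τ/2` of an integer) generate `Λ*/ℤ^T`.
* `stub_exactModes` (S4, back — THE LEVER; L, exact lattice algebra + an `FP` implementation over the tree's
  HNF / continued-fraction / Howell bricks): a poly-time `post` which, from `(T, s, n₁, ℓ)`, an integer `r` with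
  `|r − 2^{5n₁}R| ≤ 1` (REGULATOR FIRST) and a `Good` sample list, returns `[ℤ^T : Λ]` EXACTLY, for ANY
  finite-index `Λ ≤ ℤ^T` with `[ℤ^T:Λ] ≤ B = 2^{10ℓ+10}`, ANY function `ω`, `0 < R ≤ 2^{n₁}`, `n₁ ≥ c(ℓ+T+s+1)`:
  accept `j` iff `κ̃ⱼ = symm(cⱼ)(r/2^{5n₁})/2^{5n₁}` is within `τ` of an integer `kⱼ` (`|κ̃−κ| ≤ 2^{−2n₁−1}`, so
  inner-accepted ⊆ accepted ⊆ sound); an HNF `ℤ`-basis of the integer kernel of the row `(kⱼ)ⱼ` has entries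
  `≤ s·2^{4n₁}` (pivot bound: `|kⱼ| ≤ 2^{4n₁}`); for each basis vector `b`, `Σ bⱼuⱼ/M` is within
  `s²2^{4n₁}·2^{−7n₁} = s²2^{−3n₁} < 1/(2B²)` of `Σ bⱼũⱼ ∈ Λ* ⊂ (1/[ℤ^T:Λ])ℤ^T` (sum the soundness congruences) —
  rounding to the nearest fraction of denominator `≤ B` is exact; the subgroup of `(ℚ/ℤ)^T` these generate IS
  `Λ*/ℤ^T` (⊆ soundness, ⊇ completeness + `b` a `ℤ`-basis), of order `[ℤ^T:Λ]` (duality), computed by HNF mod the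
  common denominator (tree `HallgrenClassGroupLatticeHNF` / `HowellFP` / `SubgroupOrder`).
* `stub_fieldFacts` (S5; M–L, ELEMENTARY arithmetic of `ℚ(∛m)`, no analytic input): admissible `K` exists for
  non-cube `m` (`X³ − m` irreducible: Mathlib `X_pow_sub_C_irreducible_of_prime`); `|d_K| < 2^{2|x|+5}`;
  `h ≤ 2^{10|x|+10}` (Minkowski + subgroup count of `(ℤ/n)³`); `R ≤ 2^{30(|x|+4)}` (Dirichlet/Minkowski pigeonhole
  with explicit boxes; in rank one every unit of infinite order has `|log|σ₁u|| ≥ R`).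
* `stub_coreCompose` (S6; L–XL plumbing ON TREE RAILS — gen 2 names the rails): S1 + S3 + S4 + S5 ⇒ the
  card's TRANSFER `C⁺ = RankOneRelationIndexQSolvable` ("on `⟨x, ⟨primeFactorsList m, pairs⟩⟩` output
  `[ℤ^T:Λ]`", no generation claim, no Shor inside). NOT by a sequential composition of two quantum search
  algorithms (no such lemma in the tree) but by `QuantumComplexity.isQSolvable_of_generated_circuits`
  (`GeneratedCircuitsSolvable.lean`, PROVED): the classical generator writes ONE circuit = [S1's circuit for
  input `encReg x (5n₁)` on block 1] ⊔ [S3's circuit for `encInst x pairs s n₁` on block 2] (inputs written by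
  `X` gates; both families uniform ⇒ poly-time generation), the Born law of block-disjoint juxtaposed
  circuits is the product (`CircuitEmbedding.prodState`, `toMatrix_flatMap_mapWires_mulVec_prodState`,
  `MultiCopy.prob_event_prodState`), success `≥ 15/16 · 7/8 ≥ 2/3`, and the `FP` post-processor parses
  `r` (self-delimited) and the samples and runs S4's `post` with `ℓ = |x|`, `s = c₃(|x|+T+1)`,
  `n₁ = max(c₃,c₄,30)(|x|+T+s+1)+120` (S5: `R ≤ 2^{30(|x|+4)} ≤ 2^{n₁}`, `[ℤ^T:Λ] = |⟨classes⟩| ≤ h ≤ 2^{10|x|+10}`;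
  Mathlib `regulator_pos`).
* `stub_transfer` (S7; L plumbing on the `ShorAssembly` template): `C⁺` + `EscapeGeneration` + S5 +
  `FACT_mem_BQP` ⇒ `IsQSolvable classNumberRel`: a classical randomised ORACLE algorithm
  (`kernelProb_ge_uniformProb_of_mem_FPRel_holds`, coins `= 2n₀T` draw bits, `n₀ = C(|x|+2)+1`,
  `T = c(|x|+n₀+1)⁴`) with ONE oracle language `A = FACT ⊕ CoreBits ∈ BQP` (join along input-length parity,
  tree `IsQSolvable.paritySum`; `CoreBits` = the bits of `C⁺`'s unique answer on its P-checkable promise, in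
  `BQP` by `isQSolvable_classicalWrap_holds` + `mem_BQP_of_isQSolvable_bit`; the full factorisations of `m` and
  of the `|r³ − m|` by binary search on `FACT`): cube test (zeros branch — S5's existence clause makes the test a
  correct proxy for admissibility), draws ↦ pairs, query `C⁺`'s bits, output `bitsOf x N`; then
  `isQSolvable_of_mem_BQP_oracle_holds` (slack `7/8 − 2/3`); `N = [ℤ^T:Λ] = |Cl(O_K)|` on the generation event,
  and the class numbers of all admissible `K` agree by the nonemptiness trick (no iso-invariance lemma).
* `conclusion_of_qsolvable` (PROVED here): `IsQSolvable classNumberRel →` the crux's conclusion — an event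
  of probability `≥ 2/3` is nonempty, and two equal-length prefixes of one string coincide (cf. Disproof
  `conclusion_iff_canonical`, `crux_of_canonicalF_mem`).
* `PureCubicClassGroupFBQP_of_parts` / `PureCubicClassGroupFBQP_of`: the composition, concluding the crux BY NAME.

CHANGES gen 0 → gen 2 (same seven-stub cut, statements repaired where a prover would have stalled):
(a) S6 no longer presupposes an unprinted "three-stage sequential composition principle" — the tree's
`isQSolvable_of_generated_circuits` + block-product lemmas are the route; S1 therefore states an explicit
family with success `15/16` (no median amplification inside S6) and takes the factor list as input (no Shor
inside S1). (b) S2's draw rule factors `|r³ − m|` instead of extracting cube roots mod `q` (no modular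
root-finding exists in the tree; factoring does), and its size condition is on `3m`, which removes the
cube-free promise from S2, S3, `C⁺` and the canonicalisation step from S7. (c) `ω` is existential in S3's
`Good` event (S4 was already `ω`-universal), so no sign/normalisation convention of the archimedean
character is frozen in a stub signature. (d) `C⁺`'s input drops the unary `n₁` (the core chooses its own
window sizes); `coreRel` has no side constant. (e) S7's Shor hypothesis is the language form
`FACT_mem_BQP` (PROVED in tree: `FACT_mem_BQP_holds`), the shape the oracle principle consumes.

Disproof.lean (cdisprove v2.1; evidence notes — the file itself is not mounted in planner/triager jails,
and no `Cruxes/…/Disproof.lean` is published) honoured: `not_crux_iff` — `DegreeOnePrimesEscape` enters at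
S2 only and is consumed by S7 through `EscapeGeneration`; the load-bearing guards (non-cube / cube-root /
degree 3; `not_valueClauseWithout{NonCube,CubeRoot,Degree}_of`) are kept verbatim in `Adm` and in every stub
over `K`; `classNumber_eq_of_cubic` is NOT needed (nonemptiness trick, twice). Landed Negative lemmas for
THIS crux: none (`Theorems/PureCubicClassGroupFBQP*` absent); the landed `Theorems/DegreeOnePrimesEscape/
Negative/*` (EscapeCounting, EscapeSign, WithoutProperFalse) concern crux #2's anatomy and are consistent
with S2 (we only use `M ≠ ⊤` coatoms). No stub restates the crux, the summit, the route target
`PureCubicClassNumberHard`, or a refuted statement (negatives index: KummerSector / SeparableFrames /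
ShorLocallyDark / CubicForrelation — unrelated shapes).
-/

set_option linter.dupNamespace false
set_option linter.unusedVariables false

noncomputable section

open scoped Classical NumberField nonZeroDivisors

namespace Summit.QuantumAdvantage.QuantumAdvantage.Cruxes.PureCubicClassGroupFBQP.RegulatorFirstExactModes

open _root_.Computability Literature.Computability.Complexity Literature.Computability.Cryptography
open Summit.QuantumAdvantage.QuantumAdvantage.Theses.LinnikCubicClassGroups
  (DegreeOnePrimesEscape PureCubicClassGroupFBQP)

/-! ## Vocabulary (inlined notions of the line; all over existing declarations) -/

/-- `K` is an ADMISSIBLE field for the input `x`: the three load-bearing guards of the crux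
(degree `3`, `m = decodeNat x` not a cube, `K` contains a cube root of `m`). -/
def Adm (x : List Bool) (K : Type) [Field K] [NumberField K] : Prop :=
  Module.finrank ℚ K = 3 ∧ (∀ r : ℕ, r ^ 3 ≠ decodeNat x) ∧ ∃ α : K, α ^ 3 = (decodeNat x : K)

/-- The `2|x|+8` low bits of `N` (the crux's output format). -/
def bitsOf (x : List Bool) (N : ℕ) : List Bool :=
  List.ofFn fun i : Fin (2 * x.length + 8) => N.testBit i.val

/-- **The target search relation** of the line: the output has as a prefix the `2|x|+8` low bits of
`h(K)` for EVERY admissible `K`, and the all-zero word when no admissible `K` exists (cube inputs). -/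
def classNumberRel (x : List Bool) : Set (List Bool) :=
  {y | (∀ (K : Type) [Field K] [NumberField K], Adm x K → bitsOf x (NumberField.classNumber K) <+: y) ∧
    ((¬ ∃ (K : Type) (_ : Field K) (_ : NumberField K), Adm x K) →
      List.replicate (2 * x.length + 8) false <+: y)}

/-- The Boolean code of the prime factorisation of `m = decodeNat x` (Shor's / `FACT`'s output format). -/
def encFactors (x : List Bool) : List Bool :=
  encodingListNatBool.encode (decodeNat x).primeFactorsList

/-- **Input of the regulator stage S1**: `⟨x, ⟨primeFactorsList m, 1^k⟩⟩` (the factorisation is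
SUPPLIED, so that S1 needs no Shor subroutine: Dedekind's integral basis of `ℚ(∛m)` is explicit in it). -/
def encReg (x : List Bool) (k : ℕ) : List Bool :=
  boolPair x (boolPair (encFactors x) (List.replicate k true))

/-- **S1's relation**: on input `encReg x k` output, self-delimited, an integer `r` with
`|r − 2^k·R_K| ≤ 1` for every admissible `K`; no requirement on inputs of any other shape. -/
def regulatorRel (w : List Bool) : Set (List Bool) :=
  {y | ∀ (x : List Bool) (k : ℕ), w = encReg x k →
    ∀ (K : Type) [Field K] [NumberField K], Adm x K →
      ∃ (r : ℕ) (t : List Bool), y = boolPair (encodeNat r) t ∧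
        |(r : ℝ) - 2 ^ k * NumberField.Units.regulator K| ≤ 1}

/-- The `t`-th (cyclically indexed) DISTINCT prime factor of `N`, in increasing order; `0` if `N ≤ 1`. -/
def factorPick (N t : ℕ) : ℕ :=
  N.primeFactorsList.dedup.getD (t % max N.primeFactorsList.dedup.length 1) 0

/-- **The draw rule of S2** (gen 2): a draw `(r, t)` names the candidate pair `(q, r mod q)`, `q` the
`t`-th distinct prime factor of `|r³ − m|` — so `(r mod q)³ ≡ m (mod q)` automatically (`q = 0`, an
invalid pair, when `|r³ − m| ≤ 1`). -/
def drawPair (m : ℕ) (ω : ℕ × ℕ) : ℕ × ℕ :=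
  let q := factorPick (Int.natAbs ((ω.1 : ℤ) ^ 3 - m)) ω.2
  (q, ω.1 % q)

section Field

variable (K : Type) [Field K] [NumberField K]

/-- The degree-one prime `(q, θ − ρ)` of `O_K` named by a VALID pair (`q` prime, `q ∤ 3m` — hence
`q ∤ [O_K : ℤ[θ]] ∣ 3m` and Dedekind–Kummer applies —, `ρ < q`, `ρ³ ≡ m (mod q)`; `θ` a cube root of
`m` in `O_K`), the unit ideal otherwise. -/
def idealOf (θ : 𝓞 K) (m : ℕ) (p : ℕ × ℕ) : Ideal (𝓞 K) :=
  if p.1.Prime ∧ ¬ p.1 ∣ 3 * m ∧ p.2 < p.1 ∧ p.2 ^ 3 % p.1 = m % p.1 then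
    Ideal.span {(p.1 : 𝓞 K), θ - (p.2 : 𝓞 K)}
  else ⊤

/-- The ideals named by a list of pairs. -/
def idealsOf (θ : 𝓞 K) (m : ℕ) (pairs : List (ℕ × ℕ)) : Fin pairs.length → Ideal (𝓞 K) :=
  fun i => idealOf K θ m (pairs.get i)

/-- The ideal class of an ideal (`1` for the zero ideal, which never occurs). -/
def classOf (I : Ideal (𝓞 K)) : ClassGroup (𝓞 K) :=
  if h : I = 0 then 1 else ClassGroup.mk0 ⟨I, mem_nonZeroDivisors_of_ne_zero h⟩

end Field

/-- The relation homomorphism `v ↦ ∏ cᵢ^{vᵢ}` of a family of elements of a commutative group. -/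
def relHom {G : Type*} [CommGroup G] {T : ℕ} (c : Fin T → G) : (Fin T → ℤ) →+ Additive G where
  toFun v := Additive.ofMul (∏ i, c i ^ v i)
  map_zero' := by simp
  map_add' v v' := by
    simp only [Pi.add_apply, zpow_add, Finset.prod_mul_distrib, ofMul_mul]

/-- **The relation lattice** `Λ = {v ∈ ℤ^T : ∏ cᵢ^{vᵢ} = 1}`; `[ℤ^T : Λ] = |⟨cᵢ⟩|`. -/
def relLattice {G : Type*} [CommGroup G] {T : ℕ} (c : Fin T → G) : AddSubgroup (Fin T → ℤ) :=
  (relHom c).ker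

/-- A point `u` of the mode-`k` SHIFTED DUAL of `Λ` with respect to the shift function `ω`:
`⟨u, v⟩ + k·ω(v) ∈ ℤ` for all `v ∈ Λ` (mode `0`: the dual lattice `Λ* ⊇ ℤ^T`, whatever `ω` is). -/
def IsDualPt {T : ℕ} (Λ : AddSubgroup (Fin T → ℤ)) (ω : (Fin T → ℤ) → ℝ) (u : Fin T → ℝ) (k : ℤ) :
    Prop :=
  ∀ v ∈ Λ, Int.fract (∑ i, u i * v i + k * ω v) = 0

/-- Symmetric residue of `c mod q` as a real number in `(−q/2, q/2]`. -/
def symmRes (q c : ℕ) : ℝ := if 2 * c < q then (c : ℝ) else (c : ℝ) - q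

/-- The MODE STATISTIC of a sample's continuous coordinate `c ∈ [0, q)`: `κ = symm(c)·R/(qδ)` with the
line's window sizes `q = 2^{8n₁}`, `δ = 2^{−3n₁}` (so `1/(qδ) = 2^{3n₁}/2^{8n₁}`); for a good sample of
mode `k`, `κ ≈ k ∈ ℤ` — the EXACT INTEGER MODE once `R` is known. -/
def kappaOf (n₁ : ℕ) (R : ℝ) (c : ℕ) : ℝ :=
  symmRes (2 ^ (8 * n₁)) c * R * 2 ^ (3 * n₁) / 2 ^ (8 * n₁)

/-- **`Good` sample sets** (the interface between the quantum sampler S3 and the exact-modes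
post-processor S4; parameters `M = q = 2^{8n₁}`, `δ = 2^{−3n₁}`, `J = 2^{n₁}`, `τ = 2^{−n₁}`).
There is an assignment of dual data `(ũⱼ, kⱼ)` to the samples such that
(o) RANGE: `uⱼ ∈ [0,M)^T`, `cⱼ ∈ [0,q)`; (i) SOUNDNESS: every sample whose mode statistic is within `2τ` of an
integer `k` has `kⱼ = k`, `ũⱼ` in the mode-`k` shifted dual, and `|uⱼ − M·ũⱼ|_∞ ≤ J`; (ii) COMPLETENESS: every
point of `Λ*` is, mod `ℤ^T`, an integer combination `Σ cⱼ ũⱼ` with `Σ cⱼ kⱼ = 0` supported on INNER-accepted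
samples (statistic within `τ/2` of an integer). No additivity of `ω` is assumed (S4 never needs it: summing
the soundness congruences of a kernel vector kills the `ω`-terms pointwise in `v`). -/
def Good (T : ℕ) (Λ : AddSubgroup (Fin T → ℤ)) (ω : (Fin T → ℤ) → ℝ) (R : ℝ) (n₁ : ℕ)
    (S : List ((Fin T → ℕ) × ℕ)) : Prop :=
  (∀ j : Fin S.length, (S.get j).2 < 2 ^ (8 * n₁) ∧ ∀ i, (S.get j).1 i < 2 ^ (8 * n₁)) ∧
  ∃ dp : Fin S.length → (Fin T → ℝ) × ℤ,
    (∀ (j : Fin S.length) (k : ℤ), |kappaOf n₁ R (S.get j).2 - k| ≤ 2 / 2 ^ n₁ →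
      (dp j).2 = k ∧ IsDualPt Λ ω (dp j).1 k ∧
        ∀ i, |((S.get j).1 i : ℝ) - 2 ^ (8 * n₁) * (dp j).1 i| ≤ 2 ^ n₁) ∧
    (∀ u : Fin T → ℝ, IsDualPt Λ ω u 0 → ∃ c : Fin S.length → ℤ,
      (∀ j, c j ≠ 0 → ∃ k : ℤ, |kappaOf n₁ R (S.get j).2 - k| ≤ 1 / (2 * 2 ^ n₁)) ∧
      (∑ j, c j * (dp j).2 = 0) ∧
      ∀ i, Int.fract (∑ j, (c j : ℝ) * (dp j).1 i - u i) = 0)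

/-- Coding of a list of pairs of naturals. -/
def encPairs (pairs : List (ℕ × ℕ)) : List Bool :=
  encList (pairs.map fun p => boolPair (encodeNat p.1) (encodeNat p.2))

/-- **Input of the sampler S3**: `⟨x, ⟨primeFactorsList m, ⟨pairs, ⟨1^s, 1^{n₁}⟩⟩⟩⟩`. -/
def encInst (x : List Bool) (pairs : List (ℕ × ℕ)) (s n₁ : ℕ) : List Bool :=
  boolPair x (boolPair (encFactors x)
    (boolPair (encPairs pairs) (boolPair (List.replicate s true) (List.replicate n₁ true))))

/-- **Input of the quantum core `C⁺`**: `⟨x, ⟨primeFactorsList m, pairs⟩⟩` (gen 2: no unary window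
parameter — the core chooses its own `s, n₁` from `|x|` and `T = |pairs|`). -/
def encCore (x : List Bool) (pairs : List (ℕ × ℕ)) : List Bool :=
  boolPair x (boolPair (encFactors x) (encPairs pairs))

/-- Coding of a sample list `[(u₁, c₁), …]`, `uⱼ ∈ ℕ^T`. -/
def encSamples {T : ℕ} (S : List ((Fin T → ℕ) × ℕ)) : List Bool :=
  encList (S.map fun p => boolPair (encList ((List.ofFn p.1).map encodeNat)) (encodeNat p.2))

/-- The unary header `⟨1^T, ⟨1^s, ⟨1^{n₁}, 1^ℓ⟩⟩⟩` of the post-processor S4. -/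
def header (T s n₁ ℓ : ℕ) : List Bool :=
  boolPair (List.replicate T true) (boolPair (List.replicate s true)
    (boolPair (List.replicate n₁ true) (List.replicate ℓ true)))

/-- **The relation of the TRANSFER `C⁺`** (card: `RankOneRelationIndexFBQP`): on input `encCore x pairs`
output (self-delimited) the index `[ℤ^T : Λ]` of the relation lattice of the ideals named by `pairs`, for
every admissible `K` and cube root `θ ∈ O_K` of `m` (promise P-checkable given the factor list; the answer is
forced to be the same for all `(K, θ)` by solvability itself — nonemptiness of an event of probability `≥ 2/3`). -/
def coreRel (w : List Bool) : Set (List Bool) :=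
  {y | ∀ (x : List Bool) (pairs : List (ℕ × ℕ)), w = encCore x pairs →
    ∀ (K : Type) [Field K] [NumberField K] (θ : 𝓞 K), Adm x K → (θ : K) ^ 3 = (decodeNat x : K) →
      ∃ (N : ℕ) (t : List Bool), y = boolPair (encodeNat N) t ∧
        N = (relLattice fun i => classOf K (idealsOf K θ (decodeNat x) pairs i)).index}

/-- **The TRANSFER `C⁺`** of the card (`RankOneRelationIndexFBQP`, GRH-free, no generation claim, no Shor
inside): the relation-lattice index of given prime ideals of a pure cubic field is quantum poly-time computable. -/
def RankOneRelationIndexQSolvable : Prop :=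
  IsQSolvable coreRel

/-- **S2's conclusion** (gen-2 draw rule): random degree-one primes generate the class group — once
`2^{n₀} > (3m)^C` and `T ≥ c(|x|+n₀+1)⁴`, at most `1/8` of the draw sequences `ω ∈ ([0,2^{n₀}) × [0,2^{n₀}))^T`
name (through `drawPair`/`idealOf`) ideals whose classes generate a proper subgroup of `Cl(O_K)`. -/
def EscapeGeneration : Prop :=
  ∃ C c : ℕ, ∀ (x : List Bool) (K : Type) [Field K] [NumberField K] (θ : 𝓞 K),
    Adm x K → (θ : K) ^ 3 = (decodeNat x : K) →
    ∀ n₀ T : ℕ, (3 * decodeNat x) ^ C < 2 ^ n₀ → c * (x.length + n₀ + 1) ^ 4 ≤ T →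
      (Fintype.card {ω : Fin T → Fin (2 ^ n₀) × Fin (2 ^ n₀) //
          Subgroup.closure (Set.range fun i =>
            classOf K (idealOf K θ (decodeNat x)
              (drawPair (decodeNat x) ((ω i).1.val, (ω i).2.val)))) ≠ ⊤} : ℝ)
        ≤ 1 / 8 * ((2 ^ n₀ * 2 ^ n₀) ^ T : ℝ)

/-! ## Registered stubs (7) -/

/-- **S1 — `RegulatorSpec`, the statement of `stub_regulator`** (front; L–XL). A uniform oracle-free
Clifford+T family which, on `encReg x k = ⟨x, ⟨primeFactorsList m, 1^k⟩⟩` (factorisation supplied; on every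
other input the relation is trivial), outputs `⟨bin r, junk⟩` with `|r − 2^k·R_K| ≤ 1` for every admissible
`K`, with probability `≥ 15/16` (the constant is the prover's to set by the number of unit pairs: the tree's
`PeriodFindingIndependence.prob_exists_pair_ge`). The cubic twin of the tree's PROVED
`Hallgren2007_regulator_qsolvable_delim_holds` (`HallgrenPellQuantum.lean`): the principal cycle of the
complex cubic field `ℚ(∛m)` (maximal order from Dedekind's basis, `m = ab²`) with Voronoi / Buchmann–Williams
reduction as an instance of `InfrastructureNavigation.GiantStepCycle` (card `arakelov-giant-step-cycle`:
at most `6` minima per real-dyadic range, triage-checked), the `ShiftSampling` experiment on its walk table,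
comb-mass, two-sample CF, candidate check. GRH-free in print: Hallgren 2005 (unit group, constant degree),
Schmidt–Vollmer 2005. Why it might fail: only as typed; the mathematics is printed and its `r = 1`
real-quadratic instance is formalised in the tree. -/
def RegulatorSpec : Prop :=
  ∃ F : QCircuitFamily cliffordT, F.IsOracleFree ∧ F.IsUniform ∧
    ∀ w : List Bool, (15 : ℝ) / 16 ≤ F.kernelProb 0 w (regulatorRel w)

/-- **S1 `stub_regulator`** — the statement `RegulatorSpec` just above (front; L–XL). -/
theorem stub_regulator : RegulatorSpec := by
  sorry

/-- **S2 `stub_escapeSampling`** (uses the crux hypothesis `H = DegreeOnePrimesEscape`; M–L).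
`DegreeOnePrimesEscape` at `n = 3` (a cubic field has no quadratic subfield: `finrank F ∣ 3`) with
`N = 2^{n₀} − 1`, `C := max(3·C(3), 7)` (so `|d_K|^{C(3)} ≤ (27m²)^{C(3)} ≤ (3m)^C ≤ N` as `|d_K| ∣ 27m²` and
`27m² ≤ (3m)³`; `m < 2^{n₀}`; `n₀ ≥ 18`): for every maximal subgroup `M < Cl(O_K)` at least `π(N)/8 − 3(n₀+2)` degree-one primes
`P = (q, θ − ρ)` with `q ≤ N`, `q ∤ 3m` escape `M` (the primes over the `≤ n₀+2` rational primes dividing `3m`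
are discarded; Dedekind–Kummer for `ℤ[θ]` at `q ∤ 3m ⊇ q ∤ [O_K:ℤ[θ]]`). A draw `(r, t)` hits such a `P`
whenever `r ≡ ρ (mod q)` (at least one `r < 2^{n₀}`, namely `ρ`) and `t mod ν(r)` is the position of `q` among
the `ν(r) ≤ 3n₀+1` distinct prime factors of `|r³ − m| < 2^{3n₀}` (at least `2^{n₀}/(6n₀+2)` values of `t`);
distinct `P` have disjoint draw sets; with Chebyshev `π(N) ≥ N/(4 log N)` (tree:
`Literature.NumberTheory.Sieve.div_four_mul_log_le_primeCounting`) the escape probability per draw is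
`δ ≥ 1/(400 n₀²)`; then the route's support item `RandomSamplesGenerate` (stmt-QuantumAdvantage-11545, proved
candidates attached) with `#Sub(Cl) ≤ (h+1)^{log₂ h}` (tree `card_subgroup_le`) and `h ≤ 2^{10|x|+10}`
(`stub_fieldFacts`) gives failure `≤ 2^{(10|x|+11)²}·e^{−T/(400n₀²)} ≤ 1/8` for `T ≥ c(|x|+n₀+1)⁴`.
Why it might fail: only as typed (constants / an off-by-one in `N`) — restate. -/
theorem stub_escapeSampling : DegreeOnePrimesEscape → EscapeGeneration := by
  sorry

/-- **S3 — `DualSamplerSpec`, the statement of `stub_dualSampler`** (middle; XL, HARDEST; cards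
`one-blurred-coordinate` + `arakelov-giant-step-cycle`). ONE poly-time uniform oracle-free Clifford+T family:
on `encInst x pairs s n₁` (promise: `x` admissible, `s ≥ c(|x|+T+1)`, `n₁ ≥ c(|x|+T+s+1)`, `R_K ≤ 2^{n₁}`) it
outputs `⟨encSamples S, junk⟩` with `|S| = s` and, with probability `≥ 7/8`, `Good T Λ ω R_K n₁ S` for SOME
`ω` — `Λ` the relation lattice of the classes of the ideals named by `pairs` (through the cube root `θ`).
Intended witness: `ω(v) = log|σ₁(α_v)|/R` for a generator `α_v` of `∏ Pᵢ^{vᵢ}` (`v ∈ Λ`), well defined mod `ℤ`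
because the units of a complex cubic field are `±εⁿ`, `|log|σ₁ε|| = R`; the hidden lattice is
`L̃ = {(v, (ω(v)+n)R)}` with dual `{(u, k/R) : IsDualPt Λ ω u k}`. Inside: (a) the CYCLE ORACLE
`(e, j) ↦` (reduced ideal in HNF, offset `jδ − d` discretised to cells `≥ 2^{−n₁}`) of the Arakelov class of
`(∏ Pᵢ^{eᵢ}, jδ)` with TRACKED distances (Schoof 2008 Alg. 10.3–10.8; Voronoi), in `FP` hence reversible
Clifford+T, `L̃`-periodic up to a `2^{−n₁}`-fraction of grid points (state perturbation `≤ 2^{1−n₁/2}` per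
sample); (b) the COMB-MASS / Kitaev-reading analysis of the joint `ℤ_M^T × ℤ_q` sampling: per sample, all
`T+1` coordinates land within `J = 2^{n₁}` cells of a point `(Mũ, k·qδ/R)`, `IsDualPt Λ ω ũ k`, except with
probability `O((T+1)/J)` (Fejér tails); coarse cells keep the mode spectrum in `|k| ≲ R·2^{n₁} ≪ R/(2δ)` so
aliased modes carry mass `O(2^{−2n₁})`, and then `|κ − k| ≤ 2^{−3n₁} ≤ τ/2` (inner-accepted); conditional on
the mode the finite part is (nearly) uniform on its `Λ*/ℤ^T`-coset and the modes have gcd `1` w.h.p., so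
`s ≥ c(|x|+T+1) ≥ log₂[ℤ^T:Λ] + O(1)` samples make the kernel combinations generate (completeness);
(c) `s` parallel units ⇒ product law (tree `PeriodFindingIndependence`, `ShiftSampling` family pattern).
Why it might fail: the field-UNIFORM analysis of (b) is unprinted (Hallgren 2005 / Schmidt–Vollmer print
"sufficiently large q, M" for constant degree) — the honest bet of the card; a soundness leak would be a
positive-probability set of samples passing the `2τ` mode test while `J`-far from their shifted dual coset
(the `2^{3n₁}`-bin gap between the test window and the Fejér scale is the margin); constants as typed. -/
def DualSamplerSpec : Prop := ∃ (F : QCircuitFamily cliffordT) (c : ℕ), F.IsOracleFree ∧ F.IsUniform ∧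
    ∀ (x : List Bool) (pairs : List (ℕ × ℕ)) (s n₁ : ℕ) (K : Type) [Field K] [NumberField K] (θ : 𝓞 K),
      Adm x K → (θ : K) ^ 3 = (decodeNat x : K) →
      c * (x.length + pairs.length + 1) ≤ s → c * (x.length + pairs.length + s + 1) ≤ n₁ →
      NumberField.Units.regulator K ≤ 2 ^ n₁ →
      7 / 8 ≤ F.kernelProb 0 (encInst x pairs s n₁)
        {y | ∃ (S : List ((Fin pairs.length → ℕ) × ℕ)) (t : List Bool) (ω : (Fin pairs.length → ℤ) → ℝ),
          y = boolPair (encSamples S) t ∧ S.length = s ∧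
          Good pairs.length (relLattice fun i => classOf K (idealsOf K θ (decodeNat x) pairs i))
            ω (NumberField.Units.regulator K) n₁ S}

/-- **S3 `stub_dualSampler`** — the statement `DualSamplerSpec` just above (XL, HARDEST). -/
theorem stub_dualSampler : DualSamplerSpec := by
  sorry

/-- **S4 — `ExactModesSpec`, the statement of `stub_exactModes`** (back; THE LEVER of the card,
`KernelCombinationInDual` made algorithmic; L). A poly-time post-processor, correct on `Good` sample sets for
ANY finite-index `Λ ≤ ℤ^T` (index `≤ B = 2^{10ℓ+10}`) and ANY function `ω`, `0 < R ≤ 2^{n₁}`, `n₁ ≥ c(ℓ+T+s+1)`,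
GIVEN `r` with `|r − 2^{5n₁}R| ≤ 1`: accept sample `j` iff `κ̃ⱼ = symm(cⱼ)·(r/2^{5n₁})·2^{3n₁}/2^{8n₁}` is within
`τ = 2^{−n₁}` of an integer `kⱼ` (`|κ̃ⱼ − κⱼ| ≤ 2^{−2n₁−1}`, so inner ⊆ accepted ⊆ sound; `|kⱼ| ≤ 2^{4n₁}`); HNF
`ℤ`-basis of the integer kernel of the row `(kⱼ)ⱼ` (primitive part `k'`, pivot `k'_{j₀} ≠ 0`: the other
coordinates form a lattice of index `|k'_{j₀}|` in `ℤ^{s'−1}`, HNF entries `< |k'_{j₀}| ≤ 2^{4n₁}`, and the `j₀`-th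
coordinate is then `≤ s·2^{4n₁}`); for each basis vector `b`, `Σⱼ bⱼuⱼ/M` is within `s²·2^{−3n₁} < 1/(2B²)` of
`Σⱼ bⱼũⱼ ∈ Λ* ⊂ (1/[ℤ^T:Λ])ℤ^T` (sum the soundness congruences: `Σ bⱼ(⟨ũⱼ,v⟩ + kⱼω(v)) = ⟨Σ bⱼũⱼ, v⟩ ∈ ℤ`) — the
nearest fraction of denominator `≤ B` is it, exactly (tree: `IrrationalPeriodRecovery`, `ConvergentNumeratorsFP`);
the subgroup of `(ℚ/ℤ)^T` generated by these exact vectors IS `Λ*/ℤ^T` (⊆ by soundness, ⊇ by completeness: the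
witnesses of `Good` (ii) lie in the kernel LATTICE, of which `b` is a `ℤ`-basis), whose order `[ℤ^T:Λ]`
(duality `Λ*/ℤ^T ≅ Hom(ℤ^T/Λ, ℚ/ℤ)`) is read off an HNF modulo the common denominator (tree
`HallgrenClassGroupLatticeHNF`, `HallgrenClassGroupHowellFP`, `Hallgren2005.SubgroupOrder`). Consistency for
free: two `(Λ, ω, R)` meeting all hypotheses with the same data give the same generated subgroup, hence
`Λ = Λ'`. Why it might fail: only as typed (a constant in the error budget); the algebra was checked by all
three triagers; the `FP` implementation is the bulk. -/
def ExactModesSpec : Prop := ∃ post ∈ FP, ∃ c : ℕ, ∀ (T s n₁ ℓ : ℕ) (Λ : AddSubgroup (Fin T → ℤ))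
    (ω : (Fin T → ℤ) → ℝ) (R : ℝ) (r : ℕ) (S : List ((Fin T → ℕ) × ℕ)),
    Λ.index ≠ 0 → Λ.index ≤ 2 ^ (10 * ℓ + 10) →
    0 < R → R ≤ 2 ^ n₁ → c * (ℓ + T + s + 1) ≤ n₁ →
    |(r : ℝ) - 2 ^ (5 * n₁) * R| ≤ 1 → S.length = s → Good T Λ ω R n₁ S →
    post (boolPair (header T s n₁ ℓ) (boolPair (encodeNat r) (encSamples S))) = encodeNat Λ.index

/-- **S4 `stub_exactModes`** — the statement `ExactModesSpec` just above (the lever; L). -/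
theorem stub_exactModes : ExactModesSpec := by
  sorry

/-- **S5 — `FieldFacts`, the statement of `stub_fieldFacts`** (ELEMENTARY arithmetic of `ℚ(∛m)`; M–L; no
analytic number theory). (0) for a non-cube `m`, `ℚ[X]/(X³ − m)` is a number field of degree `3` with a cube
root of `m` (Mathlib `X_pow_sub_C_irreducible_of_prime`: `X³ − a` irreducible iff `a` is not a cube; cf. the
refuter's PROVED `nonempty_algEquiv_adjoinRoot_of_cubic`); for admissible `K`: (1) `|d_K| ≤ 27m² < 2^{2|x|+5}`
(`d_K · [O_K:ℤ[θ]]² = disc(X³−m) = −27m²`, `m < 2^{|x|}`); (2) `h ≤ 2^{10|x|+10}` (Minkowski: every class has an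
integral ideal of norm `≤ (4/π)(6/27)√|d_K| < 2^{|x|+1}`, Mathlib `exists_ideal_in_class_of_norm_le`; ideals of
norm `n` inject into subgroups of `(ℤ/n)³`, at most `n⁹`); (3) `R ≤ 2^{30(|x|+4)}` (Dirichlet's pigeonhole with
explicit Minkowski boxes `|y| ≤ eᵗA, |z|² ≤ e^{−t}A'`, `t ∈ D₀ℕ`: two of `≤ #{integral ideals of norm ≤ AA'} + 1`
box points generate the same ideal, their quotient is a unit `u` with `0 < |log|σ₁u|| ≤ P D₀ + D₀`; in unit rank
one `R ≤ |log|σ₁u||` for every unit of infinite order — crude, NOT the analytic `hR ≪ √d log² d`).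
Why it might fail: only as typed (an exponent). -/
def FieldFacts : Prop :=
  (∀ m : ℕ, (∀ r : ℕ, r ^ 3 ≠ m) →
      ∃ (K : Type) (_ : Field K) (_ : NumberField K), Module.finrank ℚ K = 3 ∧ ∃ α : K, α ^ 3 = (m : K)) ∧
    ∀ (x : List Bool) (K : Type) [Field K] [NumberField K], Adm x K →
      |NumberField.discr K| < 2 ^ (2 * x.length + 5) ∧
      NumberField.classNumber K ≤ 2 ^ (10 * x.length + 10) ∧
      NumberField.Units.regulator K ≤ 2 ^ (30 * (x.length + 4))

/-- **S5 `stub_fieldFacts`** — the statement `FieldFacts` just above (elementary; M–L). -/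
theorem stub_fieldFacts : FieldFacts := by
  sorry

/-- **S6 `stub_coreCompose`** (L–XL plumbing on tree rails): REGULATOR FIRST, then sample, then exact modes ⇒
the transfer `C⁺`. Route (gen 2): `QuantumComplexity.isQSolvable_of_generated_circuits`
(`GeneratedCircuitsSolvable.lean`, PROVED; needs `Rel` closed under extension — `coreRel` is, its answer being a
`boolPair` prefix). On `w = encCore x pairs` (any other `w`: `coreRel w = univ`), with `T = |pairs|`, `ℓ = |x|`,
`s := c₃(ℓ+T+1)`, `n₁ := max(c₃, c₄, 30)(ℓ+T+s+1) + 120`: the generator writes the block-disjoint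
juxtaposition of (1) `X`-gates writing `encReg x (5n₁)` then S1's circuit `F₁.circ |encReg x (5n₁)|`, and (2)
`X`-gates writing `encInst x pairs s n₁` then S3's circuit — poly-time because both families are `IsUniform`
(= `PolyTimeComputable` circuit codes) and the inputs are `FP` in `w`; the Born law on `|0…0⟩` is the product
of the two kernels (`CircuitEmbedding.toMatrix_flatMap_mapWires_mulVec_prodState`,
`MultiCopy.prob_event_prodState`, `ProdStateDistance.normSq_prodState`), so both stages succeed with
probability `≥ 15/16 · 7/8 ≥ 2/3`; the `FP` post-processor parses `⟨bin r, junk⟩` (self-delimiting) off block 1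
and `encSamples S` off block 2 and returns `boolPair (post ⟨header T s n₁ ℓ, ⟨bin r, encSamples S⟩⟩) []`. On
that event S4's hypotheses hold for every admissible `(K, θ)`: `[ℤ^T:Λ] = |⟨classes⟩|`
(`AddMonoidHom.ker`/`QuotientAddGroup.quotientKerEquivRange`) is `≠ 0` and `≤ h ≤ 2^{10ℓ+10}` (S5(2)),
`0 < R` (Mathlib `NumberField.Units.regulator_pos`), `R ≤ 2^{30(ℓ+4)} ≤ 2^{n₁}` (S5(3)), `|r − 2^{5n₁}R| ≤ 1`
(S1's event), `Good` for S3's `ω` (S3's event) — so the output is `bin [ℤ^T:Λ]`. Why it might fail: plumbing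
only; the one genuinely new brick is "two uniform families' circuits juxtaposed on disjoint blocks, run on
`|0⟩`, have the product Born law", assembled from the `prodState` lemmas. -/
theorem stub_coreCompose (hreg : RegulatorSpec) (hsamp : DualSamplerSpec) (hpost : ExactModesSpec)
    (hfacts : FieldFacts) : RankOneRelationIndexQSolvable := by
  sorry

/-- **S7 `stub_transfer`** (`C⁺ →` crux form; L plumbing on the `ShorAssembly` template). From `C⁺`,
`EscapeGeneration` (constants `C, c`), the field facts and `FACT ∈ BQP`: (i) the ORACLE `A := FACT ⊕ CoreBits`
(join along input-length parity, tree `IsQSolvable.paritySum` + `mem_BQP_of_isQSolvable_bit`), where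
`CoreBits = {⟨w, bin i⟩ : w = encCore x pairs well-formed with the listed primes multiplying to a non-cube m
(P-checkable: AKS), bit i of THE index}` is in `BQP` by `isQSolvable_classicalWrap_holds` applied to `C⁺`
(post-processor: re-check the promise, output `[testBit N i]`; off-promise `[false]`); (ii) the classical
randomised oracle algorithm `G ∈ FP^A` on `⟨x, coins⟩`: if `m` is a cube output `0^{2|x|+8}` (S5(0): cube ⇔ no
admissible `K`); else `n₀ := C(|x|+2)+1` (`2^{n₀} > (3m)^C` as `m < 2^{|x|}`), `T := c(|x|+n₀+1)⁴`, read `2n₀T`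
coins as the draws `ω`, factor `m` and every `|rᵢ³ − m|` by binary search on `FACT`, `pairs := drawPair m ∘ ω`,
read `bin N` off `CoreBits` on `encCore x pairs` (`N < 2^{10|x|+10}` bits to ask), output `bitsOf x N`;
(iii) `kernelProb_ge_uniformProb_of_mem_FPRel_holds` + `isQSolvable_of_mem_BQP_oracle_holds` (slack
`7/8 − 2/3`; `classNumberRel` is closed under extension). Correctness: for a fixed admissible `(K₀, θ₀)` the
coins generate `Cl(O_{K₀})` with probability `≥ 7/8` (`EscapeGeneration`), and then `N = [ℤ^T:Λ] = |Cl(O_{K₀})|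
= classNumber K₀` (`Subgroup.card_top`); for any other admissible `K₁` the two generation events meet
(probability `≥ 3/4 > 0`), whence `classNumber K₁ = classNumber K₀` — no iso-invariance lemma needed. -/
theorem stub_transfer (hcore : RankOneRelationIndexQSolvable) (hgen : EscapeGeneration)
    (hfacts : FieldFacts) (hfact : FACT_mem_BQP) : IsQSolvable classNumberRel := by
  sorry

/-! ## Composition (sorry-free) -/

/-- An event of kernel probability `≥ 2/3` is nonempty. -/
theorem nonempty_of_kernelProb_ge {F : QCircuitFamily cliffordT} {x : List Bool} {E : Set (List Bool)}
    (h : 2 / 3 ≤ F.kernelProb 0 x E) : E.Nonempty := by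
  by_contra hE
  rw [Set.not_nonempty_iff_eq_empty] at hE
  subst hE
  simp [QCircuitFamily.kernelProb] at h
  norm_num at h

/-- **The value function of the line**: the low bits of the class number of SOME admissible field if
there is one, the zero word otherwise (its independence of the choice is NOT assumed — it follows from
solvability, `conclusion_of_qsolvable`). -/
def valueOf (x : List Bool) : List Bool :=
  if h : ∃ (K : Type) (_ : Field K) (_ : NumberField K), Adm x K then
    bitsOf x (@NumberField.classNumber h.choose h.choose_spec.choose h.choose_spec.choose_spec.choose)
  else List.replicate (2 * x.length + 8) false

theorem length_valueOf (x : List Bool) : (valueOf x).length = 2 * x.length + 8 := by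
  unfold valueOf
  split_ifs <;> simp [bitsOf]

/-- **From solvability of `classNumberRel` to the crux's conclusion** (real proof): `valueOf ∈ FBQP` by
monotonicity; its length is `2|x|+8`; and for EVERY admissible `K` it equals the low bits of `h(K)`,
because the solved event is nonempty and two prefixes of one string of the same length are equal. -/
theorem conclusion_of_qsolvable (h : IsQSolvable classNumberRel) :
    ∃ f : List Bool → List Bool, f ∈ Literature.Computability.Cryptography.FBQP ∧
      (∀ x, (f x).length = 2 * x.length + 8) ∧
      ∀ (x : List Bool) (K : Type) [Field K] [NumberField K], Module.finrank ℚ K = 3 →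
        (∀ r : ℕ, r ^ 3 ≠ Computability.decodeNat x) →
        (∃ α : K, α ^ 3 = (Computability.decodeNat x : K)) →
        f x = List.ofFn (fun i : Fin (2 * x.length + 8) => (NumberField.classNumber K).testBit i.val) := by
  have hne : ∀ x, (classNumberRel x).Nonempty := by
    obtain ⟨F, -, -, hF⟩ := h
    exact fun x => nonempty_of_kernelProb_ge (hF x)
  refine ⟨valueOf, ?_, length_valueOf, ?_⟩
  · show IsQSolvable fun x => {y | valueOf x <+: y}
    refine h.mono fun x y hy => ?_
    simp only [classNumberRel, Set.mem_setOf_eq] at hy ⊢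
    obtain ⟨hy1, hy2⟩ := hy
    unfold valueOf
    split_ifs with hx
    · exact @hy1 hx.choose hx.choose_spec.choose hx.choose_spec.choose_spec.choose
        hx.choose_spec.choose_spec.choose_spec
    · exact hy2 hx
  · intro x K _ _ hdeg hnc hα
    have hadm : Adm x K := ⟨hdeg, hnc, hα⟩
    have hx : ∃ (K : Type) (_ : Field K) (_ : NumberField K), Adm x K := ⟨K, _, _, hadm⟩
    obtain ⟨y, hy⟩ := hne x
    simp only [classNumberRel, Set.mem_setOf_eq] at hy
    obtain ⟨hy1, hy2⟩ := hy
    have h1 : valueOf x <+: y := by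
      unfold valueOf
      rw [dif_pos hx]
      exact @hy1 hx.choose hx.choose_spec.choose hx.choose_spec.choose_spec.choose
        hx.choose_spec.choose_spec.choose_spec
    have h2 : bitsOf x (NumberField.classNumber K) <+: y := hy1 K hadm
    have hlen : (valueOf x).length = (bitsOf x (NumberField.classNumber K)).length := by
      simp [length_valueOf, bitsOf]
    exact (List.prefix_of_prefix_length_le h1 h2 hlen.le).eq_of_length hlen

/-- **The composition over the seven stub STATEMENTS** (kernel-checked, no `sorry` of its own):
regulator → escape sampling → dual sampler → exact modes → field facts → core composition → transfer → the
crux's conclusion under its hypothesis `DegreeOnePrimesEscape` (stated unfolded, so that exactly ONE theorem of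
this file — `PureCubicClassGroupFBQP_of` below — concludes the crux decl by name). `FACT ∈ BQP` is the tree's
PROVED `FACT_mem_BQP_holds` (Shor). -/
theorem PureCubicClassGroupFBQP_of_parts (h1 : RegulatorSpec)
    (h2 : DegreeOnePrimesEscape → EscapeGeneration) (h3 : DualSamplerSpec) (h4 : ExactModesSpec)
    (h5 : FieldFacts)
    (h6 : RegulatorSpec → DualSamplerSpec → ExactModesSpec → FieldFacts → RankOneRelationIndexQSolvable)
    (h7 : RankOneRelationIndexQSolvable → EscapeGeneration → FieldFacts → FACT_mem_BQP →
      IsQSolvable classNumberRel)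
    (hE : DegreeOnePrimesEscape) :
    ∃ f : List Bool → List Bool, f ∈ Literature.Computability.Cryptography.FBQP ∧
      (∀ x, (f x).length = 2 * x.length + 8) ∧
      ∀ (x : List Bool) (K : Type) [Field K] [NumberField K], Module.finrank ℚ K = 3 →
        (∀ r : ℕ, r ^ 3 ≠ Computability.decodeNat x) →
        (∃ α : K, α ^ 3 = (Computability.decodeNat x : K)) →
        f x = List.ofFn (fun i : Fin (2 * x.length + 8) => (NumberField.classNumber K).testBit i.val) :=
  conclusion_of_qsolvable (h7 (h6 h1 h3 h4 h5) (h2 hE) h5 FACT_mem_BQP_holds)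

/-- **The skeleton concludes the crux BY NAME**: `LinnikCubicClassGroups.PureCubicClassGroupFBQP`
(stmt-QuantumAdvantage-11544) from the seven registered stubs (no hypotheses; `sorry` only inside the stubs). -/
theorem PureCubicClassGroupFBQP_of :
    Summit.QuantumAdvantage.QuantumAdvantage.Theses.LinnikCubicClassGroups.PureCubicClassGroupFBQP :=
  fun hE => PureCubicClassGroupFBQP_of_parts stub_regulator stub_escapeSampling stub_dualSampler
    stub_exactModes stub_fieldFacts stub_coreCompose stub_transfer hE

end Summit.QuantumAdvantage.QuantumAdvantage.Cruxes.PureCubicClassGroupFBQP.RegulatorFirstExactModes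

end
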